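import Summits.NavierStokesRegularity.NavierStokesRegularity.Theorems.HardyPointSinkHardyEnergyBoundLedgerCutoff
import Literature.Analysis.FluidPDE.RieszPressureSpaceTime
import Literature.Analysis.FluidPDE.KatoMaximalTime
import Literature.Analysis.FluidPDE.PressureNormalisationL3
import Mathlib.MeasureTheory.Integral.IntervalIntegral.Basic
import HarnessLib

/-!
# Route HardyPointSink — `HardyEnergyBound`, ledger stub: the Riesz pressure along the Kato curve

Helper file 5/5 for the glue stub `stub_hardyLedger_of` (item stmt-NavierStokesRegularity-7979, line
`birth`). Along a Kato solution `u ∈ C([0,T); L³)` and its classical representative `v`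
(`v t = u t` a.e.), the Riesz pressure `s ↦ Π[v s] = Π[u s]` is continuous into `L^{3/2}` on every
`[0, S']`, `S' < T` (Lipschitz bound `eLpNorm_rieszPressure_sub_le_mul` on the bounded curve); hence
its ball means are continuous in time (the normalising constant `c(s)` of `p(s) = Π[v s] + c(s)` is
then continuous in time: main file). Also: the space–time `L³` bound in iterated form (Tonelli), and
the `lintegral`/Bochner conversions used to read the crux's `ℝ≥0∞`-valued Hardy energy and dissipation
off the Bochner-form identity (`φ = 1` on `B̄(xs, R/2)`), plus the bound of the initial weighted energy.
-/

noncomputable section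

open MeasureTheory Set Filter Topology Metric Function
open scoped ENNReal NNReal InnerProductSpace Laplacian

set_option linter.dupNamespace false -- nested layout Summit.<S>.<Sub>, Sub = S (D-0017)

namespace Summit.NavierStokesRegularity.NavierStokesRegularity.Theorems

open Literature.Analysis.FluidPDE Literature.Analysis.PDE


section Kato

variable {T ν : ℝ} {u₀ : (EuclideanSpace ℝ (Fin 3)) → (EuclideanSpace ℝ (Fin 3))} {u v : ℝ → (EuclideanSpace ℝ (Fin 3)) → (EuclideanSpace ℝ (Fin 3))} (hu : IsKatoSolutionOn T ν u₀ u)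
  (hae : ∀ t ∈ Ioo 0 T, v t =ᵐ[volume] u t) {S' : ℝ} (hS'T : S' < T)

include hu hS'T in
/-- **`s ↦ Π[u s]` is continuous into `L^{3/2}` on `[0, S']`, `S' < T`.** -/
theorem hardyEnergyBound_ledger_tendsto_rieszPressure {s₀ : ℝ} (hs₀ : s₀ ∈ Icc 0 S') :
    Tendsto (fun s => eLpNorm (rieszPressure (u s) - rieszPressure (u s₀)) (3 / 2 : ℝ≥0∞) volume)
      (𝓝[Icc 0 S'] s₀) (𝓝 0) := by
  have hsub : Icc 0 S' ⊆ Ico 0 T := fun s hs => ⟨hs.1, hs.2.trans_lt hS'T⟩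
  have hu' : ContinuousInLpOn (Icc 0 S') 3 u := hu.continuousInLpOn.mono hsub
  obtain ⟨M, hM⟩ := hu'.exists_forall_eLpNorm_le_Icc
  set L : ℝ≥0∞ := 4 * steinConstThreeHalves * (1 + (2 * (M : ℝ≥0∞)) ^ 2) with hL
  have hLt : L ≠ ⊤ := ENNReal.mul_ne_top (ENNReal.mul_ne_top (by norm_num) ENNReal.coe_ne_top)
    (ENNReal.add_ne_top.2 ⟨ENNReal.one_ne_top,
      ENNReal.pow_ne_top (ENNReal.mul_ne_top (by norm_num) ENNReal.coe_ne_top)⟩)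
  have hlim : Tendsto (fun s => L * eLpNorm (u s - u s₀) 3 volume) (𝓝[Icc 0 S'] s₀) (𝓝 0) := by
    have h := ENNReal.Tendsto.const_mul (hu'.2 s₀ hs₀) (Or.inr hLt)
    rwa [mul_zero] at h
  refine tendsto_of_tendsto_of_tendsto_of_le_of_le' tendsto_const_nhds hlim
    (Eventually.of_forall fun s => zero_le) ?_
  filter_upwards [self_mem_nhdsWithin] with s hs
  exact eLpNorm_rieszPressure_sub_le_mul (hu'.1 s hs) (hu'.1 s₀ hs₀) (hM s hs) (hM s₀ hs₀)

include hu hae in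
/-- Slices of the representative are `L³` fields. -/
theorem hardyEnergyBound_ledger_memLp_three {s : ℝ} (hs : s ∈ Ioo 0 T) : MemLp (v s) 3 volume :=
  (hu.memLp ⟨hs.1.le, hs.2⟩).ae_eq (hae s hs).symm

include hu hae hS'T in
/-- **The ball means `s ↦ ∫_{B̄} Π[v s]` are continuous in time** on every `K ⊆ (0, S')`. -/
theorem hardyEnergyBound_ledger_continuousOn_rieszPressureMean {K : Set ℝ} (hK : K ⊆ Ioo 0 S')
    (xs : (EuclideanSpace ℝ (Fin 3))) (R : ℝ) :
    ContinuousOn (fun s => ∫ x in closedBall xs R, rieszPressure (v s) x) K := by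
  have h32 : (1 : ℝ≥0∞) ≤ 3 / 2 :=
    ((ENNReal.lt_div_iff_mul_lt (Or.inl (by norm_num)) (Or.inl (by norm_num))).2 (by norm_num)).le
  have hKI : K ⊆ Icc 0 S' := fun s hs => ⟨(hK hs).1.le, (hK hs).2.le⟩
  have hKT : ∀ s ∈ K, s ∈ Ioo 0 T := fun s hs => ⟨(hK hs).1, (hK hs).2.trans hS'T⟩
  have hu3 : ∀ s ∈ K, MemLp (u s) 3 volume := fun s hs => hu.memLp ⟨(hK hs).1.le, (hKT s hs).2⟩
  have hPi : ∀ s ∈ K, rieszPressure (v s) =ᵐ[volume] rieszPressure (u s) := fun s hs =>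
    rieszPressure_congr_ae (hae s (hKT s hs)) (hu3 s hs)
  have hint : ∀ s ∈ K, IntegrableOn (rieszPressure (u s)) (closedBall xs R) := fun s hs =>
    ((memLp_rieszPressure (hu3 s hs)).locallyIntegrable h32).integrableOn_isCompact
      (isCompact_closedBall xs R)
  have heq : ∀ s ∈ K, ∫ x in closedBall xs R, rieszPressure (v s) x =
      ∫ x in closedBall xs R, rieszPressure (u s) x := fun s hs =>
    integral_congr_ae (ae_restrict_of_ae (hPi s hs))
  intro s₀ hs₀
  set V3 : ℝ := ((volume : Measure (EuclideanSpace ℝ (Fin 3))).real (closedBall xs R)) ^ (3 : ℝ)⁻¹ with hV3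
  have h1 : Tendsto (fun s => eLpNorm (rieszPressure (u s) - rieszPressure (u s₀)) (3 / 2 : ℝ≥0∞)
      volume) (𝓝[K] s₀) (𝓝 0) :=
    (hardyEnergyBound_ledger_tendsto_rieszPressure hu hS'T (hKI hs₀)).mono_left (nhdsWithin_mono _ hKI)
  have h2 : Tendsto (fun s => V3 * (eLpNorm (rieszPressure (u s) - rieszPressure (u s₀))
      (3 / 2 : ℝ≥0∞) volume).toReal) (𝓝[K] s₀) (𝓝 0) := by
    have h := ((ENNReal.tendsto_toReal ENNReal.zero_ne_top).comp h1).const_mul V3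
    simpa using h
  rw [ContinuousWithinAt, tendsto_iff_norm_sub_tendsto_zero]
  refine squeeze_zero' (Eventually.of_forall fun s => norm_nonneg _) ?_ h2
  filter_upwards [self_mem_nhdsWithin] with s hs
  rw [heq s hs, heq s₀ hs₀, ← integral_sub (hint s hs) (hint s₀ hs₀), Real.norm_eq_abs]
  calc |∫ x in closedBall xs R, (rieszPressure (u s) x - rieszPressure (u s₀) x)|
      ≤ ∫ x in closedBall xs R, |rieszPressure (u s) x - rieszPressure (u s₀) x| :=
        abs_integral_le_integral_abs
    _ ≤ V3 * (eLpNorm (rieszPressure (u s) - rieszPressure (u s₀)) (3 / 2 : ℝ≥0∞) volume).toReal :=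
        PressureNormalisationL3.setIntegral_abs_le_of_memLp
          ((memLp_rieszPressure (hu3 s hs)).sub (memLp_rieszPressure (hu3 s₀ hs₀))) xs R

end Kato

/-! ### The space–time `L³` bound in iterated form -/

/-- **Tonelli**: a finite space–time `L³` integral of a field continuous on the open strip gives a
finite iterated integral `∫_{(a,T)} ∫ |v|³ < ∞`. -/
theorem hardyEnergyBound_ledger_lintegral_lintegral_lt_top {v : ℝ → (EuclideanSpace ℝ (Fin 3)) → (EuclideanSpace ℝ (Fin 3))} {a T : ℝ}
    (hv : ContinuousOn (uncurry v) (Ioo a T ×ˢ univ))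
    (h : ∫⁻ z in Ioo a T ×ˢ (univ : Set (EuclideanSpace ℝ (Fin 3))), ‖v z.1 z.2‖ₑ ^ (3 : ℝ) < ⊤) :
    ∫⁻ s in Ioo a T, ∫⁻ x, ‖v s x‖ₑ ^ 3 < ⊤ := by
  have hm : AEStronglyMeasurable (uncurry v)
      ((volume : Measure (ℝ × (EuclideanSpace ℝ (Fin 3)))).restrict (Ioo a T ×ˢ univ)) :=
    hv.aestronglyMeasurable (measurableSet_Ioo.prod MeasurableSet.univ)
  have hmeas : AEMeasurable (fun z : ℝ × (EuclideanSpace ℝ (Fin 3)) => ‖v z.1 z.2‖ₑ ^ (3 : ℝ))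
      (((volume : Measure ℝ).restrict (Ioo a T)).prod (volume : Measure (EuclideanSpace ℝ (Fin 3)))) := by
    rw [Measure.restrict_prod_eq_prod_univ]
    exact (hm.enorm.pow_const _)
  have hprod : ∫⁻ z, ‖v z.1 z.2‖ₑ ^ (3 : ℝ) ∂(((volume : Measure ℝ).restrict (Ioo a T)).prod
      (volume : Measure (EuclideanSpace ℝ (Fin 3)))) < ⊤ := by
    rw [Measure.restrict_prod_eq_prod_univ]
    exact h
  rw [lintegral_prod _ hmeas] at hprod
  have e : ∀ y : ℝ≥0∞, y ^ (3 : ℝ) = y ^ (3 : ℕ) := fun y => by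
    rw [← ENNReal.rpow_natCast]
    norm_num
  simp_rw [e] at hprod
  exact hprod

/-! ### `lintegral` / Bochner conversions -/

/-- `ofReal ∫ |w|³ = ∫⁻ |w|³` for `w ∈ L³`. -/
theorem hardyEnergyBound_ledger_ofReal_integral_cube {w : (EuclideanSpace ℝ (Fin 3)) → (EuclideanSpace ℝ (Fin 3))} (hw3 : MemLp w 3 volume) :
    ENNReal.ofReal (∫ x, ‖w x‖ ^ 3) = ∫⁻ x, ‖w x‖ₑ ^ 3 := by
  rw [ofReal_integral_eq_lintegral_ofReal (hw3.integrable_norm_pow three_ne_zero)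
    (Eventually.of_forall fun x => by positivity)]
  refine lintegral_congr fun x => ?_
  rw [← ofReal_norm, ENNReal.ofReal_pow (norm_nonneg _)]

/-- **The weighted density is integrable**: for continuous `g`, `x ↦ φ(x) g(x) / |x − x₀|` is
integrable (`φ` the plateau cut-off). -/
theorem hardyEnergyBound_ledger_integrable_weighted (xs : (EuclideanSpace ℝ (Fin 3))) {R : ℝ} (hR : 0 < R) {g : (EuclideanSpace ℝ (Fin 3)) → ℝ}
    (hg : Continuous g) (x₀ : (EuclideanSpace ℝ (Fin 3))) :
    Integrable fun x => hardyEnergyBound_ledger_cutoff xs hR x * g x / ‖x - x₀‖ := by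
  have e : (fun x => hardyEnergyBound_ledger_cutoff xs hR x * g x / ‖x - x₀‖) =
      fun x => hardyEnergyBound_ledger_cutoff xs hR x * g x * ‖x - x₀‖⁻¹ := by
    funext x; rw [div_eq_mul_inv]
  rw [e]
  have hK : IntegrableOn (fun x => hardyEnergyBound_ledger_cutoff xs hR x * g x * ‖x - x₀‖⁻¹)
      (closedBall xs R) :=
    IntegrableOn.continuousOn_mul (((hardyEnergyBound_ledger_cutoff_continuous xs hR).mul hg).continuousOn)
      (hardyEnergyBound_ledger_integrableOn_inv_closedBall x₀ xs R) (isCompact_closedBall xs R)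
  refine (integrableOn_iff_integrable_of_support_subset (fun x hx => ?_)).1 hK
  by_contra h
  have h0 : hardyEnergyBound_ledger_cutoff xs hR x = 0 := by
    by_contra h'
    exact h (ball_subset_closedBall (hardyEnergyBound_ledger_mem_ball_of_cutoff_ne_zero xs hR h'))
  exact hx (by simp only; rw [h0, zero_mul, zero_mul])

/-- **Sharp-ball `lintegral` against the weighted Bochner integral.** For continuous `g ≥ 0` and
`ρ ≤ R/2`: `∫⁻_{B(xs,ρ)} ofReal(g)/|x − x₀|ₑ ≤ ofReal ∫ φ g / |x − x₀|`. -/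
theorem hardyEnergyBound_ledger_setLIntegral_le_ofReal (xs : (EuclideanSpace ℝ (Fin 3))) {R : ℝ} (hR : 0 < R) {ρ : ℝ}
    (hρ : ρ ≤ R / 2) {g : (EuclideanSpace ℝ (Fin 3)) → ℝ} (hg : Continuous g) (hg0 : ∀ x, 0 ≤ g x) (x₀ : (EuclideanSpace ℝ (Fin 3))) :
    ∫⁻ x in ball xs ρ, ENNReal.ofReal (g x) / ‖x - x₀‖ₑ ≤
      ENNReal.ofReal (∫ x, hardyEnergyBound_ledger_cutoff xs hR x * g x / ‖x - x₀‖) := by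
  have hint := hardyEnergyBound_ledger_integrable_weighted xs hR hg x₀
  have hnn : 0 ≤ᵐ[volume] fun x => hardyEnergyBound_ledger_cutoff xs hR x * g x / ‖x - x₀‖ :=
    Eventually.of_forall fun x => div_nonneg
      (mul_nonneg (hardyEnergyBound_ledger_cutoff_nonneg xs hR x) (hg0 x)) (norm_nonneg _)
  rw [ofReal_integral_eq_lintegral_ofReal hint hnn]
  refine le_trans (lintegral_mono_ae ?_) (setLIntegral_le_lintegral (ball xs ρ) _)
  filter_upwards [ae_restrict_mem measurableSet_ball,
    ae_restrict_of_ae (s := ball xs ρ) (hardyPointSink_ae_ne x₀)] with x hx hne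
  have h1 : hardyEnergyBound_ledger_cutoff xs hR x = 1 :=
    hardyEnergyBound_ledger_cutoff_eq_one xs hR ((mem_ball.1 hx).le.trans hρ)
  have hr : 0 < ‖x - x₀‖ := norm_pos_iff.2 (sub_ne_zero.2 hne)
  rw [h1, one_mul, ENNReal.ofReal_div_of_pos hr, ofReal_norm]

/-- **Time `lintegral` of `ofReal` of a continuous nonnegative function over `(a, b)` is `ofReal` of
its interval integral.** -/
theorem hardyEnergyBound_ledger_lintegral_Ioo_eq_ofReal {Z : ℝ → ℝ} {a b : ℝ} (hab : a ≤ b)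
    (hZ : ContinuousOn Z (Icc a b)) (hZ0 : ∀ s ∈ Icc a b, 0 ≤ Z s) :
    ∫⁻ s in Ioo a b, ENNReal.ofReal (Z s) = ENNReal.ofReal (∫ s in a..b, Z s) := by
  have hint : IntegrableOn Z (Ioo a b) := hZ.integrableOn_Icc.mono_set Ioo_subset_Icc_self
  have hnn : 0 ≤ᵐ[volume.restrict (Ioo a b)] Z :=
    (ae_restrict_iff' measurableSet_Ioo).2 (Eventually.of_forall fun s hs => hZ0 s (Ioo_subset_Icc_self hs))
  rw [intervalIntegral.integral_of_le hab, integral_Ioc_eq_integral_Ioo,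
    ofReal_integral_eq_lintegral_ofReal hint hnn]

/-- **The weighted Hardy energy of one slice is bounded by `sup_{B̄} |w|² · (5/2)|B₁|R²`**, uniformly in
the sink `x₀`. -/
theorem hardyEnergyBound_ledger_weightedEnergy_le (xs : (EuclideanSpace ℝ (Fin 3))) {R : ℝ} (hR : 0 < R) {w : (EuclideanSpace ℝ (Fin 3)) → (EuclideanSpace ℝ (Fin 3))}
    {M : ℝ} (hM : ∀ x ∈ closedBall xs R, ‖w x‖ ≤ M) (x₀ : (EuclideanSpace ℝ (Fin 3))) :
    ∫ x, hardyEnergyBound_ledger_cutoff xs hR x * ‖w x‖ ^ 2 / ‖x - x₀‖ ≤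
      M ^ 2 * (5 / 2 * (volume : Measure (EuclideanSpace ℝ (Fin 3))).real (ball 0 1) * R ^ 2) := by
  have hg : Integrable ((ball xs R).indicator fun x => M ^ 2 * ‖x - x₀‖⁻¹) :=
    IntegrableOn.integrable_indicator
      ((hardyEnergyBound_ledger_integrableOn_inv x₀ xs R).const_mul (M ^ 2)) measurableSet_ball
  have hle : ∀ x, hardyEnergyBound_ledger_cutoff xs hR x * ‖w x‖ ^ 2 / ‖x - x₀‖ ≤
      (ball xs R).indicator (fun x => M ^ 2 * ‖x - x₀‖⁻¹) x := fun x => by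
    by_cases hx : x ∈ ball xs R
    · rw [indicator_of_mem hx, div_eq_mul_inv]
      have hMx := hM x (ball_subset_closedBall hx)
      have h2 : ‖w x‖ ^ 2 ≤ M ^ 2 := pow_le_pow_left₀ (norm_nonneg _) hMx 2
      refine mul_le_mul ?_ le_rfl (inv_nonneg.2 (norm_nonneg _)) (by positivity)
      calc hardyEnergyBound_ledger_cutoff xs hR x * ‖w x‖ ^ 2 ≤ 1 * ‖w x‖ ^ 2 :=
            mul_le_mul_of_nonneg_right (hardyEnergyBound_ledger_cutoff_le_one xs hR x) (by positivity)
        _ ≤ M ^ 2 := by rw [one_mul]; exact h2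
    · rw [indicator_of_notMem hx]
      have h0 : hardyEnergyBound_ledger_cutoff xs hR x = 0 := by
        by_contra h
        exact hx (hardyEnergyBound_ledger_mem_ball_of_cutoff_ne_zero xs hR h)
      rw [h0, zero_mul, zero_div]
  have hnn : 0 ≤ᵐ[volume] fun x => hardyEnergyBound_ledger_cutoff xs hR x * ‖w x‖ ^ 2 / ‖x - x₀‖ :=
    Eventually.of_forall fun x => div_nonneg
      (mul_nonneg (hardyEnergyBound_ledger_cutoff_nonneg xs hR x) (by positivity)) (norm_nonneg _)
  calc ∫ x, hardyEnergyBound_ledger_cutoff xs hR x * ‖w x‖ ^ 2 / ‖x - x₀‖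
      ≤ ∫ x, (ball xs R).indicator (fun x => M ^ 2 * ‖x - x₀‖⁻¹) x :=
        integral_mono_of_nonneg hnn hg (Eventually.of_forall hle)
    _ = M ^ 2 * ∫ x in ball xs R, ‖x - x₀‖⁻¹ := by
        rw [integral_indicator measurableSet_ball, integral_const_mul]
    _ ≤ M ^ 2 * (5 / 2 * (volume : Measure (EuclideanSpace ℝ (Fin 3))).real (ball 0 1) * R ^ 2) :=
        mul_le_mul_of_nonneg_left (hardyEnergyBound_ledger_setIntegral_inv_le x₀ xs hR) (by positivity)

/-- **Anchor of this helper file** (registered sub-goal of `stub_hardyLedger_of`): along a Kato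
solution the Riesz pressure is continuous into `L^{3/2}` on `[0, S]`, `S < T`. -/
theorem hardyEnergyBound_ledger_rieszPressureCurve :
    ∀ (T ν : ℝ) (a : EuclideanSpace ℝ (Fin 3) → EuclideanSpace ℝ (Fin 3))
      (u : ℝ → EuclideanSpace ℝ (Fin 3) → EuclideanSpace ℝ (Fin 3)),
      Literature.Analysis.FluidPDE.IsKatoSolutionOn T ν a u → ∀ (S : ℝ), S < T → ∀ (c : ℝ),
      c ∈ Set.Icc 0 S →
      Filter.Tendsto (fun s => MeasureTheory.eLpNorm (Literature.Analysis.FluidPDE.rieszPressure (u s) -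
        Literature.Analysis.FluidPDE.rieszPressure (u c)) (3 / 2 : ENNReal) MeasureTheory.volume)
        (nhdsWithin c (Set.Icc 0 S)) (nhds 0) :=
  fun _ _ _ _ hu _ hST _ hc => hardyEnergyBound_ledger_tendsto_rieszPressure hu hST hc

end Summit.NavierStokesRegularity.NavierStokesRegularity.Theorems

end
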